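import Literature.Analysis.PDE.ParabolicHolderCompactness
import HarnessLib

/-!
# Interpolation inequalities for first derivatives (elliptic and parabolic)

Topic `Literature/Analysis/PDE` (support for the parabolic Schauder theory in the vocabulary of
`ParabolicHolderNorm.lean`).  Elementary interpolation of a first derivative between the function
and a Lipschitz bound on the derivative:

* `norm_deriv_le_interpolate` — one variable: if `‖f‖ ≤ M₀` on `[-ρ, ρ]` and
  `‖f'(s) - f'(0)‖ ≤ M₂ |s|`, then `‖f'(0)‖ ≤ M₀/ρ + M₂ ρ`;
* `norm_fderiv_le_interpolate` — several variables, along segments: `‖Dg(x)‖ ≤ M₀/ρ + M₂ ρ` if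
  `‖g‖ ≤ M₀` and `‖Dg(y) - Dg(x)‖ ≤ M₂ ‖y - x‖` on `B̄(x, ρ)` (`norm_fderiv_le_interpolate'`: the
  Lipschitz bound from a bound `M₂` on `D²g`);
* `norm_spaceDeriv_sub_le_sqrt` — **parabolic interpolation**: for `u` on parabolic spacetime with
  `‖∂ₜu‖ ≤ M₁` and `‖D²u‖ ≤ M₂` (on a region containing `B̄(x, √|s - t|) × [t, s]`),
  `‖Du(x, s) - Du(x, t)‖ ≤ (M₁ + 2 M₂) √|s - t|` — the spatial gradient of a `C^{2,1}` function is
  `½`-Hölder in time (apply the several-variable inequality with `ρ = √|s - t|` to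
  `u(·, s) - u(·, t)`, which is `O(|s - t|)` by the mean value theorem in time);
  `norm_spaceDeriv_sub_le_sqrt_of_isC21On` is the version on the unit parabolic ball `B^{m,1}`.

These are the standard interpolation steps of the Schauder theory (Lieberman 1996, Ch. IV,
Lemma 4.3 area; Krylov, *Lectures on elliptic and parabolic equations in Hölder spaces*, §8.8);
the elementary proofs here are self-contained.  Everything is PROVED; no definitions.

## References

* [Lieberman1996] G. M. Lieberman, *Second Order Parabolic Differential Equations*, World
  Scientific 1996, Ch. IV (interpolation inequalities in parabolic Hölder spaces).
-/

noncomputable section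

open Set Filter Metric Topology

namespace Literature.Analysis.PDE

open Parabolic

variable {E : Type*} [NormedAddCommGroup E] [NormedSpace ℝ E]
variable {F : Type*} [NormedAddCommGroup F] [NormedSpace ℝ F]

/-! ### One variable -/

/-- **Interpolation in one variable**: if `f` has derivative `f'` within `[-ρ, ρ]`, `‖f‖ ≤ M₀`
there and `‖f'(s) - f'(0)‖ ≤ M₂ |s|`, then `‖f'(0)‖ ≤ M₀/ρ + M₂ ρ` (compare `f(±ρ)` with the
affine Taylor polynomial at `0`). [folklore] -/
theorem norm_deriv_le_interpolate {f f' : ℝ → F} {ρ M₀ M₂ : ℝ} (hρ : 0 < ρ)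
    (hf : ∀ s ∈ Icc (-ρ) ρ, HasDerivWithinAt f (f' s) (Icc (-ρ) ρ) s)
    (h0 : ∀ s ∈ Icc (-ρ) ρ, ‖f s‖ ≤ M₀) (h2 : ∀ s ∈ Icc (-ρ) ρ, ‖f' s - f' 0‖ ≤ M₂ * |s|) :
    ‖f' 0‖ ≤ M₀ / ρ + M₂ * ρ := by
  -- `φ(s) = f(s) - s • f'(0)` has `‖φ'‖ ≤ M₂ ρ` on `[-ρ, ρ]`
  have hφd : ∀ s ∈ Icc (-ρ) ρ, HasDerivWithinAt (fun s => f s - s • f' 0) (f' s - f' 0)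
      (Icc (-ρ) ρ) s := fun s hs => by
    have h := (hf s hs).sub ((hasDerivWithinAt_id s _).smul_const (f' 0))
    simpa [Pi.sub_def] using h
  have hφb : ∀ s ∈ Icc (-ρ) ρ, ‖f' s - f' 0‖ ≤ M₂ * ρ := fun s hs =>
    (h2 s hs).trans (mul_le_mul_of_nonneg_left (abs_le.2 ⟨by linarith [hs.1], hs.2⟩)
      (by
        have h := (norm_nonneg _).trans (h2 ρ ⟨by linarith, le_rfl⟩)
        rw [abs_of_pos hρ] at h
        nlinarith))
  have hconv : Convex ℝ (Icc (-ρ) ρ) := convex_Icc _ _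
  have h0mem : (0 : ℝ) ∈ Icc (-ρ) ρ := ⟨by linarith, hρ.le⟩
  have hA : ‖(f ρ - ρ • f' 0) - (f 0 - (0 : ℝ) • f' 0)‖ ≤ M₂ * ρ * ‖ρ - (0 : ℝ)‖ :=
    hconv.norm_image_sub_le_of_norm_hasDerivWithin_le hφd hφb h0mem ⟨by linarith, le_rfl⟩
  have hB : ‖(f (-ρ) - (-ρ) • f' 0) - (f 0 - (0 : ℝ) • f' 0)‖ ≤ M₂ * ρ * ‖-ρ - (0 : ℝ)‖ :=
    hconv.norm_image_sub_le_of_norm_hasDerivWithin_le hφd hφb h0mem ⟨le_rfl, by linarith⟩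
  rw [sub_zero, Real.norm_eq_abs, abs_of_pos hρ] at hA
  rw [sub_zero, Real.norm_eq_abs, abs_neg, abs_of_pos hρ] at hB
  -- `2ρ • f'(0) = (φ(-ρ) - φ 0) - (φ ρ - φ 0) + f ρ - f(-ρ)`
  have hid : (2 * ρ) • f' 0 = ((f (-ρ) - (-ρ) • f' 0) - (f 0 - (0 : ℝ) • f' 0)) -
      ((f ρ - ρ • f' 0) - (f 0 - (0 : ℝ) • f' 0)) + (f ρ - f (-ρ)) := by
    simp only [neg_smul, zero_smul, sub_zero]
    rw [two_mul, add_smul]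
    abel
  have hn : ‖(2 * ρ) • f' 0‖ ≤ M₂ * ρ * ρ + M₂ * ρ * ρ + (M₀ + M₀) := by
    rw [hid]
    refine (norm_add_le _ _).trans (add_le_add ((norm_sub_le _ _).trans (add_le_add hB hA)) ?_)
    exact (norm_sub_le _ _).trans (add_le_add (h0 ρ ⟨by linarith, le_rfl⟩)
      (h0 (-ρ) ⟨le_rfl, by linarith⟩))
  rw [norm_smul, Real.norm_eq_abs, abs_of_pos (by positivity)] at hn
  rw [div_add' _ _ _ hρ.ne', le_div_iff₀ hρ]
  nlinarith

/-! ### Several variables -/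

omit [NormedSpace ℝ F] in
/-- An operator-norm bound from a bound on the unit ball. [folklore] -/
theorem opNorm_le_of_unit_ball [NormedSpace ℝ F] (f : E →L[ℝ] F) {K : ℝ} (hK : 0 ≤ K)
    (h : ∀ v, ‖v‖ ≤ 1 → ‖f v‖ ≤ K) : ‖f‖ ≤ K := by
  refine ContinuousLinearMap.opNorm_le_bound f hK fun v => ?_
  rcases eq_or_ne v 0 with rfl | hv
  · simp
  have hv' : 0 < ‖v‖ := norm_pos_iff.2 hv
  have h1 := h (‖v‖⁻¹ • v) (by rw [norm_smul, norm_inv, norm_norm, inv_mul_cancel₀ hv'.ne'])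
  rw [map_smul, norm_smul, norm_inv, norm_norm, inv_mul_le_iff₀ hv'] at h1
  simpa [mul_comm] using h1

/-- **Interpolation of the gradient along segments**: if `g` has the Fréchet derivative `Dg`
at the points of `B̄(x, ρ)`, `‖g‖ ≤ M₀` there and `‖Dg(y) - Dg(x)‖ ≤ M₂ ‖y - x‖`, then
`‖Dg(x)‖ ≤ M₀/ρ + M₂ ρ`. [folklore] -/
theorem norm_fderiv_le_interpolate {g : E → F} {Dg : E → E →L[ℝ] F} {x : E} {ρ M₀ M₂ : ℝ}
    (hρ : 0 < ρ) (hM₂ : 0 ≤ M₂) (hg : ∀ y ∈ closedBall x ρ, HasFDerivAt g (Dg y) y)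
    (h0 : ∀ y ∈ closedBall x ρ, ‖g y‖ ≤ M₀)
    (h2 : ∀ y ∈ closedBall x ρ, ‖Dg y - Dg x‖ ≤ M₂ * ‖y - x‖) : ‖Dg x‖ ≤ M₀ / ρ + M₂ * ρ := by
  have hM₀ : 0 ≤ M₀ := (norm_nonneg _).trans (h0 x (mem_closedBall_self hρ.le))
  refine opNorm_le_of_unit_ball _ (by positivity) fun v hv => ?_
  -- restrict to the segment `s ↦ x + s • v`, `s ∈ [-ρ, ρ]`
  have hmem : ∀ s ∈ Icc (-ρ) ρ, x + s • v ∈ closedBall x ρ := fun s hs => by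
    rw [mem_closedBall, dist_eq_norm, add_sub_cancel_left, norm_smul, Real.norm_eq_abs]
    calc |s| * ‖v‖ ≤ ρ * 1 := mul_le_mul (abs_le.2 ⟨hs.1, hs.2⟩) hv (norm_nonneg _) hρ.le
      _ = ρ := mul_one ρ
  have hf : ∀ s ∈ Icc (-ρ) ρ, HasDerivWithinAt (fun s : ℝ => g (x + s • v)) (Dg (x + s • v) v)
      (Icc (-ρ) ρ) s := fun s hs => by
    have hl : HasDerivAt (fun s : ℝ => x + s • v) v s := by
      simpa using ((hasDerivAt_id s).smul_const v).const_add x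
    exact ((hg _ (hmem s hs)).comp_hasDerivAt s hl).hasDerivWithinAt
  have key := norm_deriv_le_interpolate (f' := fun s => Dg (x + s • v) v) (M₂ := M₂) hρ hf
    (fun s hs => h0 _ (hmem s hs)) fun s hs => ?_
  · simpa using key
  · have hsub : Dg (x + s • v) v - Dg (x + (0 : ℝ) • v) v = (Dg (x + s • v) - Dg x) v := by
      rw [zero_smul, add_zero]; rfl
    rw [hsub]
    calc ‖(Dg (x + s • v) - Dg x) v‖ ≤ ‖Dg (x + s • v) - Dg x‖ * ‖v‖ :=
          ContinuousLinearMap.le_opNorm _ _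
      _ ≤ M₂ * ‖x + s • v - x‖ * 1 :=
          mul_le_mul (h2 _ (hmem s hs)) hv (norm_nonneg _)
            (mul_nonneg hM₂ (norm_nonneg _))
      _ = M₂ * (|s| * ‖v‖) := by rw [add_sub_cancel_left, norm_smul, Real.norm_eq_abs, mul_one]
      _ ≤ M₂ * (|s| * 1) := by gcongr
      _ = M₂ * |s| := by rw [mul_one]

/-- The Lipschitz bound on the gradient from a bound on the second derivative: if `Dg` has the
derivative `D2g` on `B̄(x, ρ)` with `‖D2g‖ ≤ M₂`, then `‖Dg(y) - Dg(x)‖ ≤ M₂ ‖y - x‖` there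
(mean value inequality on the convex ball), whence `‖Dg(x)‖ ≤ M₀/ρ + M₂ ρ`. [folklore] -/
theorem norm_fderiv_le_interpolate' {g : E → F} {Dg : E → E →L[ℝ] F}
    {D2g : E → E →L[ℝ] E →L[ℝ] F} {x : E} {ρ M₀ M₂ : ℝ} (hρ : 0 < ρ)
    (hg : ∀ y ∈ closedBall x ρ, HasFDerivAt g (Dg y) y)
    (hDg : ∀ y ∈ closedBall x ρ, HasFDerivAt Dg (D2g y) y)
    (h0 : ∀ y ∈ closedBall x ρ, ‖g y‖ ≤ M₀) (h2 : ∀ y ∈ closedBall x ρ, ‖D2g y‖ ≤ M₂) :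
    ‖Dg x‖ ≤ M₀ / ρ + M₂ * ρ := by
  have hM₂ : 0 ≤ M₂ := (norm_nonneg (D2g x)).trans (h2 x (mem_closedBall_self hρ.le))
  refine norm_fderiv_le_interpolate hρ hM₂ hg h0 fun y hy => ?_
  exact (convex_closedBall x ρ).norm_image_sub_le_of_norm_hasFDerivWithin_le
    (fun z hz => (hDg z hz).hasFDerivWithinAt) h2 (mem_closedBall_self hρ.le) hy

/-! ### Parabolic interpolation: the gradient is `½`-Hölder in time -/

/-- **Parabolic interpolation inequality** (unbundled form).  Let `u` be a function on parabolic
spacetime, `x` a point, `t, s` two times and `ρ = √|s - t| > 0`.  Suppose that on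
`B̄(x, ρ) × [t, s]` the time slices of `u` have derivatives bounded by `M₁`, and that at the two
times `t`, `s` the space slices have Fréchet derivatives `Du` with
`‖Du(y, ·) - Du(x, ·)‖ ≤ M₂ ‖y - x‖` on `B̄(x, ρ)`.  Then
`‖Du(x, s) - Du(x, t)‖ ≤ (M₁ + 2 M₂) √|s - t|`. [cite: Lieberman1996, Ch. IV] -/
theorem norm_spaceDeriv_sub_le_sqrt {u : Parabolic E → F} {Du : Parabolic E → E →L[ℝ] F}
    {ut : Parabolic E → F} {x : E} {t s M₁ M₂ : ℝ} (hts : t ≠ s) (hM₂ : 0 ≤ M₂)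
    (hDu : ∀ τ ∈ ({t, s} : Set ℝ), ∀ y ∈ closedBall x (Real.sqrt |s - t|),
      HasFDerivAt (fun y' => u ⟨y', τ⟩) (Du ⟨y, τ⟩) y)
    (hLip : ∀ τ ∈ ({t, s} : Set ℝ), ∀ y ∈ closedBall x (Real.sqrt |s - t|),
      ‖Du ⟨y, τ⟩ - Du ⟨x, τ⟩‖ ≤ M₂ * ‖y - x‖)
    (hut : ∀ y ∈ closedBall x (Real.sqrt |s - t|), ∀ τ ∈ uIcc t s,
      HasDerivWithinAt (fun τ' => u ⟨y, τ'⟩) (ut ⟨y, τ⟩) (uIcc t s) τ)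
    (hM₁ : ∀ y ∈ closedBall x (Real.sqrt |s - t|), ∀ τ ∈ uIcc t s, ‖ut ⟨y, τ⟩‖ ≤ M₁) :
    ‖Du ⟨x, s⟩ - Du ⟨x, t⟩‖ ≤ (M₁ + 2 * M₂) * Real.sqrt |s - t| := by
  set ρ : ℝ := Real.sqrt |s - t| with hρ
  have hst : 0 < |s - t| := abs_pos.2 (sub_ne_zero.2 (Ne.symm hts))
  have hρ0 : 0 < ρ := Real.sqrt_pos.2 hst
  have hρ2 : ρ ^ 2 = |s - t| := Real.sq_sqrt hst.le
  -- the difference of the two time slices is `O(|s - t|)` with `2M₂`-Lipschitz gradient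
  set g : E → F := fun y => u ⟨y, s⟩ - u ⟨y, t⟩ with hg
  have hgD : ∀ y ∈ closedBall x ρ, HasFDerivAt g (Du ⟨y, s⟩ - Du ⟨y, t⟩) y := fun y hy =>
    (hDu s (by simp) y hy).sub (hDu t (by simp) y hy)
  have hg0 : ∀ y ∈ closedBall x ρ, ‖g y‖ ≤ M₁ * |s - t| := by
    intro y hy
    have h := (convex_uIcc t s).norm_image_sub_le_of_norm_hasDerivWithin_le (hut y hy) (hM₁ y hy)
      left_mem_uIcc right_mem_uIcc
    simpa [hg, Real.norm_eq_abs] using h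
  have hgLip : ∀ y ∈ closedBall x ρ,
      ‖(Du ⟨y, s⟩ - Du ⟨y, t⟩) - (Du ⟨x, s⟩ - Du ⟨x, t⟩)‖ ≤ (2 * M₂) * ‖y - x‖ := by
    intro y hy
    calc ‖(Du ⟨y, s⟩ - Du ⟨y, t⟩) - (Du ⟨x, s⟩ - Du ⟨x, t⟩)‖
        = ‖(Du ⟨y, s⟩ - Du ⟨x, s⟩) - (Du ⟨y, t⟩ - Du ⟨x, t⟩)‖ := by abel_nf
      _ ≤ ‖Du ⟨y, s⟩ - Du ⟨x, s⟩‖ + ‖Du ⟨y, t⟩ - Du ⟨x, t⟩‖ := norm_sub_le _ _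
      _ ≤ M₂ * ‖y - x‖ + M₂ * ‖y - x‖ := add_le_add (hLip s (by simp) y hy) (hLip t (by simp) y hy)
      _ = (2 * M₂) * ‖y - x‖ := by ring
  have key := norm_fderiv_le_interpolate (Dg := fun y => Du ⟨y, s⟩ - Du ⟨y, t⟩) hρ0
    (by positivity) hgD hg0 hgLip
  calc ‖Du ⟨x, s⟩ - Du ⟨x, t⟩‖ ≤ M₁ * |s - t| / ρ + 2 * M₂ * ρ := key
    _ = (M₁ + 2 * M₂) * ρ := by
        rw [← hρ2]
        field_simp

/-- **Parabolic interpolation on the unit ball** `B = B^{m,1}`: if `u` satisfies the regularity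
guard `IsC21On u B` with `‖∂ₜu‖ ≤ M₁` and `‖D²u‖ ≤ M₂` on `B`, then for `X = (x, s)`, `Y = (x, t)`
with `B̄(x, √|s - t|) × [t, s] ⊆ B` (guaranteed by `‖x‖ + √|s - t| < 1`, `|s|, |t| < 1`):
`‖Du(x, s) - Du(x, t)‖ ≤ (M₁ + 2 M₂) √|s - t|`. [cite: Lieberman1996, Ch. IV] -/
theorem norm_spaceDeriv_sub_le_sqrt_of_isC21On {u : Parabolic E → F}
    (hC : IsC21On u (ball 0 1)) {M₁ M₂ : ℝ}
    (hM₁ : ∀ X ∈ ball (0 : Parabolic E) 1, ‖timeDeriv u X‖ ≤ M₁)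
    (hM₂ : ∀ X ∈ ball (0 : Parabolic E) 1, ‖spaceDeriv (spaceDeriv u) X‖ ≤ M₂)
    {x : E} {s t : ℝ} (hs : |s| < 1) (ht : |t| < 1) (hx : ‖x‖ + Real.sqrt |s - t| < 1) :
    ‖spaceDeriv u ⟨x, s⟩ - spaceDeriv u ⟨x, t⟩‖ ≤ (M₁ + 2 * M₂) * Real.sqrt |s - t| := by
  rcases eq_or_ne t s with rfl | hts
  · simp
  set ρ : ℝ := Real.sqrt |s - t| with hρ
  -- the region `B̄(x, ρ) × [t, s]` lies in the unit parabolic ball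
  have hτ : ∀ τ ∈ uIcc t s, |τ| < 1 := fun τ hτ => by
    rcases le_total t s with h | h
    · rw [uIcc_of_le h] at hτ
      exact abs_lt.2 ⟨by linarith [hτ.1, (abs_lt.1 ht).1], by linarith [hτ.2, (abs_lt.1 hs).2]⟩
    · rw [uIcc_of_ge h] at hτ
      exact abs_lt.2 ⟨by linarith [hτ.1, (abs_lt.1 hs).1], by linarith [hτ.2, (abs_lt.1 ht).2]⟩
  have hyball : ∀ y ∈ closedBall x ρ, ‖y‖ < 1 := fun y hy => by
    have h1 : ‖y - x‖ ≤ ρ := by rwa [mem_closedBall, dist_eq_norm] at hy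
    have h2 : ‖y‖ ≤ ‖x‖ + ‖y - x‖ := norm_le_norm_add_norm_sub' y x
    linarith [Real.sqrt_nonneg |s - t|]
  have hmem : ∀ y ∈ closedBall x ρ, ∀ τ ∈ uIcc t s,
      (⟨y, τ⟩ : Parabolic E) ∈ ball (0 : Parabolic E) 1 :=
    fun y hy τ hτ' => (mem_ball_zero_one_iff _).2 ⟨hyball y hy, hτ τ hτ'⟩
  have hM₂0 : 0 ≤ M₂ := (norm_nonneg (spaceDeriv (spaceDeriv u) ⟨x, t⟩)).trans
    (hM₂ _ (hmem x (mem_closedBall_self (Real.sqrt_nonneg _)) t left_mem_uIcc))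
  refine norm_spaceDeriv_sub_le_sqrt (Du := spaceDeriv u) (ut := timeDeriv u) hts hM₂0
    (fun τ hτ' y hy => hC.hasFDerivAt_space (hmem y hy τ ?_)) (fun τ hτ' y hy => ?_)
    (fun y hy τ hτ' => (hC.hasDerivAt_time (hmem y hy τ hτ')).hasDerivWithinAt)
    (fun y hy τ hτ' => hM₁ _ (hmem y hy τ hτ'))
  · rcases hτ' with rfl | rfl
    · exact left_mem_uIcc
    · exact right_mem_uIcc
  · -- the Lipschitz bound from `‖D²u‖ ≤ M₂` on the convex ball at time `τ`
    have hτm : τ ∈ uIcc t s := by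
      rcases hτ' with rfl | rfl
      · exact left_mem_uIcc
      · exact right_mem_uIcc
    exact (convex_closedBall x ρ).norm_image_sub_le_of_norm_hasFDerivWithin_le
      (f := fun y' => spaceDeriv u ⟨y', τ⟩)
      (fun z hz => (hC.hasFDerivAt_spaceDeriv (hmem z hz τ hτm)).hasFDerivWithinAt)
      (fun z hz => hM₂ _ (hmem z hz τ hτm)) (mem_closedBall_self (Real.sqrt_nonneg _)) hy

end Literature.Analysis.PDE
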